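import Summits.QuantumFields.YangMills.Theorems.UnitScaleTiltProp7CoarseGramInverseTdistDecay
import Summits.QuantumFields.YangMills.Theorems.UnitScaleTiltProp7TopMeanAdjointBlockLocal
import HarnessLib

/-!
# Route `UnitScaleTilt`, crux K1 «MinimiserStabilityRegPr» (stmt-QuantumFields-19200), EX row `hGF[Lift]` ∕ `h349[Lift]` (curved member) — **LOD LINE BRICK (L5′-member), FILE B4
# (routeR-w2 g12, LOCATE-L5-GRAMSHELLS 7416633c road (G), chair-adopted 22:38:36Z; w5 g13 00:40:38Z «which theorem exports the block bound of `P`'s kernel»): THE KERNEL OF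
# PRINT'S COMPLEMENTARY GAUGE PROJECTOR `P = 1 − R_{Q″}(U₀)` DECAYS EXPONENTIALLY BETWEEN COARSE BLOCKS — `|⟪toL2S u, P(toL2S w)⟫| ≤ β(z,z′)·‖toL2S u‖·‖toL2S w‖`,
# `β(z,z′) = (8C_P²C_T e^{3μ})²·C_N(μ′)·(4(2(1 + 1∕(μ−μ′)))³)²·e^{−μ′·tdist(z,z′)}` for `u` supported in `B(z)`, `w` in `B(z′)`, every pair of slopes `0 ≤ μ′ < μ` in the window —
# the assembled β-row of the B-series (B1 ✓p750882 ⊕ B2c ⊕ B3 ✓p752577 through ✓p749838's triple sum).**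

Cell `ym3-torus` (HUMAN RULING D-0037, YM ladder rung R3 — NOT d = 4, NOT infinite volume, NOT a mass gap, NOT Clay).  Width seat `ym-routeR-w2` gen 12 (D-0154 (3c); ★p1 g24 22:38:36Z ∕
23:28:16Z ∕ 00:40:07Z CHAIR BOOK; ★★OWNER RULINGS №33∕№35).  THEOREMS ONLY (0 `def`, 0 `sorry`); px5 g11's member letters VERBATIM + `G hAG hGA`; `--supports stmt-QuantumFields-19200 --as helper`,
count-neutral.  HONEST LABEL (№33 (6)): curved γ-row ∕ (3.49) supplier line (LOD localisation), the block bound `β(X,Y)` of `P`'s kernel that w5 g13's `hK₂` (c) and the (L6) knit consume;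
CONDITIONAL on the coarse coercivity `hcoer` ((L4′), px10 g9's knit) and on the window hypotheses `hδ`∕`hwin` (slope `μ`) and `hgap` (slope `μ′`) — the consumer's choice of `μ′ < μ`; nothing
of (3.49), Thm 3.1∕3.3, `h349`, `hGF`, (L5″), (L6), EX ∕ 19200 is proved here; no summit statement is proved by this seat.

THE MATHEMATICS.  In the coarse site⊗entry spike basis `b_c` (px17 ✓`orthonormal_spike`), print's `P = 1 − projR Δ_{U₀} Q″` is `Σ_{i,i′} |v_i⟩(M⁻¹)_{ii′}⟨v_{i′}|`, `v_i = G(T(b_c i))`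
(B1 ✓`sub_projR_eq_gramSum`), so `|⟪f, Pg⟫| ≤ Σ A_i‖M⁻¹ i i′‖B_{i′}` (B1 ✓`norm_inner_sub_projR_le`).  §1: the source `T(b_c i)` of a spike column is supported in the block `B(σ i.1)`
(px17 ✓`adjoint_apply_eq_zero_off_block` with ✓`inner_blockLift_eq_zero_of_disjoint`), so B1's (A-L²) column row ✓`norm_inner_massive_column_le` with px12's B3 weight at `y = σ i.1`
gives `A_i ≤ 8C_P²C_T e^{3μ}‖toL2S u‖·e^{−μ·tdist(z, σ i.1)}` for `u ⊂ B(z)` (§2).  §3: with B2c ✓`norm_gram_inv_spike_le_exp_neg_tdist` at slope `μ′` (`hN`, `C_N(μ′) = (m_B²∕2 −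
3ε(μ′)²)⁻¹e^{9μ′}`; its window `hδ` at `μ′` follows from the one at `μ` by monotonicity), the pseudo-metric `dc i j = tdist(σ i.1, σ j.1)` (B3 (W3)) and the coarse volume
`Σ_i e^{−(μ−μ′)dc} ≤ 4·(2(1 + 1∕(μ−μ′)))³` (B3 (W2), `×4` entries, reindexed along `σ`), ✓p749838 `triple_sum_exp_le` at the index representatives `i_z = (σ⁻¹z, (0,0))` sums the series.

WHAT IS PROVED (ns `Summit.QuantumFields.YangMills.Theorems.Prop7ComplementaryProjectorBlockDecay`).
* §1 `inner_lift_eq_zero_of_disjoint` (the member reading `ι` is sitewise), ★ `spike_column_source_eq_zero_off_block` (`T(b_c i)` is supported in `B(σ i.1)`).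
* §2 ★★ `norm_inner_spike_column_le` (`‖⟪G(T(b_c i)), toL2S u⟫‖ ≤ 8C_P²·C_T·e^{3μ}·‖toL2S u‖·e^{−μ·tdist(z, σ i.1)}` for `u ⊂ B(z)`).
* §3 `window_mono` (the window row `hδ` is monotone in the slope), `sum_exp_neg_mul_dc_spike_le` (coarse volume over the spike index), ★★★ `norm_inner_sub_projR_blocks_le` (the β-row).

References: T. Bałaban, CMP **99** (1985) 389–434 [Balaban1985BackgroundPropagators] ((3.11) p.392, (3.16) p.393, (3.21)–(3.25) p.394, Thm 3.1 (3.46) p.398, (3.49) p.399);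
CMP **116** (1988) 1–22 [Balaban1988RG2Cluster] ((2.7) p.13); S. Agmon (1982) Ch. 1 [folklore].
-/

set_option autoImplicit false

noncomputable section

open scoped BigOperators Matrix.Norms.L2Operator InnerProductSpace ComplexConjugate Matrix

namespace Summit.QuantumFields.YangMills.Theorems.Prop7ComplementaryProjectorBlockDecay

open Literature.MathematicalPhysics.QuantumFieldTheory.Balaban1983to89
open Finset
open T4Continuum BlockAveraging
open BlockAveraging (Idx)
open B7Prop1Explicit (U1 disp)
open B5Eq118OneStroke (iterBlockOf iterBlock mem_iterBlock card_iterBlock)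
open B10Eq27TorusAxialLog (holT transl)
open B7TransferAnalyticMean (meanCLM)
open B9Eq311L2Pairing (WL2)
open B11Eq103H1Complex (SiteL2K BondL2K projR)
open Summit.QuantumFields.YangMills.Theorems.Prop8Chart (emlIterU)
open Literature.MathematicalPhysics.QuantumFieldTheory.Balaban1983to89.T3ContinuumYM3Torus
open T3SectALandauChart (eta eta_pos bgUnits)
open T3PrintedRegularMinimiser (RegPr)
open T3PrintedRegularOrbits (sites_eq)
open T3LevelShift (siteShift)
open Summit.QuantumFields.YangMills.Theorems.Prop7SectET3Transport (periodsT3)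
open Summit.QuantumFields.YangMills.Theorems.Prop7SectET3HilbertLetters (W₂ toL2 toL2S DL2 DstarL2 covLapSite adjoint_DL2 inner_toL2)
open Summit.QuantumFields.YangMills.Theorems.Prop7SectET3RealCoordSums (inner_toL2S)
open Summit.QuantumFields.YangMills.Theorems.Prop7MassivePropagatorAgmonLetters (topMean_blockConst_smul inner_toL2S_smul_left norm_toL2S_smul_le)
open Summit.QuantumFields.YangMills.Theorems.Prop7MassiveConjugateResolvent (lift_topMean_weight_eq norm_weight_massive_inverse_sub_le)
open Summit.QuantumFields.YangMills.Theorems.Prop7ComplementaryProjectorColumns (norm_adjoint_le)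
open Summit.QuantumFields.YangMills.Theorems.Prop7GramConjAccretive (gram_inv_entry_decay)
open Summit.QuantumFields.YangMills.Theorems.Prop7SpanProjectorGramForm (gram_eq_conjTranspose_mul_coords triple_sum_exp_le)
open Summit.QuantumFields.YangMills.Theorems.Prop7SiteEntryCoordinates (orthonormal_spike top_le_span_spike inner_spike_toL2S norm_sq_sum_smul_orthonormalBasis)
open Summit.QuantumFields.YangMills.Theorems.Prop7BlockDistanceWeights (exists_blockDistanceWeight sum_exp_neg_mul_tdist_coarse_le tdist_coarse_comm tdist_coarse_triangle)
open Summit.QuantumFields.YangMills.Theorems.Prop7ComplementaryProjectorColumns (isUnit_gram_massive_columns norm_inner_sub_projR_le norm_inner_massive_column_le)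
open Summit.QuantumFields.YangMills.Theorems.Prop7CoarseGramInverseDecay (spike_eq_lift norm_gram_inv_spike_le_exp_neg_tdist)
open Summit.QuantumFields.YangMills.Theorems.Prop7TopMeanAdjointBlockLocal (inner_blockLift_eq_zero_of_disjoint adjoint_apply_eq_zero_off_block)
open Literature.MathematicalPhysics.QuantumFieldTheory.Balaban1983to89.Beta.CombesThomasForm (abs_exp_sub_one_le)

variable (F : T3Family) {n K : ℕ} (h : n ≤ K) {c₀ c₁ : ℝ} [Fact (0 < c₀)] [Fact (0 < c₁)]
  {ε₀ : ℝ} (hε₀ : 0 < ε₀) (hε7 : 10 ^ 7 * (F.L : ℝ) ^ 3 * ε₀ ≤ 1)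
  (U₀ : GaugeField (F.P K) 0 (Matrix.specialUnitaryGroup (Fin 2) ℂ)) (hreg : RegPr F n K ε₀ U₀)
  (Q'' : SiteL2K ℂ 3 (periodsT3 F K) c₀ W₂ →ₗ[ℂ] (Site (F.P K) (K - n) → Matrix (Fin 2) (Fin 2) ℂ))
  (hseq : ∀ lam : Site (F.P K) 0 → Matrix (Fin 2) (Fin 2) ℂ, ∃ ns : (j : ℕ) → Site (F.P K) j → Matrix (Fin 2) (Fin 2) ℂ, ns 0 = lam ∧
      (∀ (j : ℕ) (y : Site (F.P K) (j + 1)), ns (j + 1) y = ns j (emb y) - meanCLM (Idx (F.P K)) (Matrix (Fin 2) (Fin 2) ℂ) fun i : Idx (F.P K) =>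
        ns j (emb y) - ((holT (emlIterU j (bgUnits F K U₀)) (emb y) (stairWord i.2.1 (off i.1)) : (Matrix (Fin 2) (Fin 2) ℂ)ˣ) : Matrix (Fin 2) (Fin 2) ℂ) *
          ns j (transl (emb y) (disp (stairWord i.2.1 (off i.1)))) * (((holT (emlIterU j (bgUnits F K U₀)) (emb y) (stairWord i.2.1 (off i.1)))⁻¹ : (Matrix (Fin 2) (Fin 2) ℂ)ˣ) : Matrix (Fin 2) (Fin 2) ℂ)) ∧
      ns (K - n) = Q'' (toL2S F K c₀ lam))
  (ι : (Site (F.P K) (K - n) → Matrix (Fin 2) (Fin 2) ℂ) →ₗ[ℂ] SiteL2K ℂ 3 (periodsT3 F n) c₁ W₂)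
  (hι : ∀ c, ι c = toL2S F n c₁ (fun z => c (siteShift (sites_eq F n K h) z)))
  (T : SiteL2K ℂ 3 (periodsT3 F n) c₁ W₂ →ₗ[ℂ] SiteL2K ℂ 3 (periodsT3 F K) c₀ W₂)
  (hT : ∀ (l : SiteL2K ℂ 3 (periodsT3 F K) c₀ W₂) (f : SiteL2K ℂ 3 (periodsT3 F n) c₁ W₂), ⟪ι (Q'' l), f⟫_ℂ = ⟪l, T f⟫_ℂ)
  {a : ℝ} (ha : 0 < a)
  (G : SiteL2K ℂ 3 (periodsT3 F K) c₀ W₂ →ₗ[ℂ] SiteL2K ℂ 3 (periodsT3 F K) c₀ W₂)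
  (hAG : ∀ f, covLapSite F n K c₀ U₀ (G f) + (a : ℂ) • T (ι (Q'' (G f))) = f)
  (hGA : ∀ u, G (covLapSite F n K c₀ U₀ u + (a : ℂ) • T (ι (Q'' u))) = u)

/-! ## §1 The source of a spike column is supported in one block -/

include hι in
omit [Fact (0 < c₀)] in
/-- The member reading `ι` (`hι`) is SITEWISE: coarse sections with disjoint supports have orthogonal lifts (px17 ✓`inner_blockLift_eq_zero_of_disjoint`) — the `hι` of
✓`adjoint_apply_eq_zero_off_block`. [cite: Balaban1985BackgroundPropagators, (3.16) p.393] -/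
theorem inner_lift_eq_zero_of_disjoint (c c' : Site (F.P K) (K - n) → Matrix (Fin 2) (Fin 2) ℂ) (hcc' : ∀ y, c y = 0 ∨ c' y = 0) :
    ⟪ι c, ι c'⟫_ℂ = 0 := by
  rw [hι c, hι c']
  exact inner_blockLift_eq_zero_of_disjoint F h c c' hcc'

include hseq hι hT in
/-- ★ **THE SOURCE `T(b_c i)` OF A SPIKE COLUMN IS SUPPORTED IN THE BLOCK `B(σ i.1)`**: `(toL2S)⁻¹(T(b_c i)) x = 0` off `B^{K−n}(σ i.1)` — B2c ✓`spike_eq_lift` (`b_c i = ι(δ_{σ i.1}⊗…)`)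
and px17 ✓`adjoint_apply_eq_zero_off_block`. [cite: Balaban1985BackgroundPropagators, (3.21)-(3.25) p.394] -/
theorem spike_column_source_eq_zero_off_block (i : Site (F.P n) 0 × (Fin 2 × Fin 2)) (x : Site (F.P K) 0)
    (hx : iterBlockOf (K - n) x ≠ siteShift (sites_eq F n K h) i.1) :
    (toL2S F K c₀).symm (T ((OrthonormalBasis.mk (orthonormal_spike F) (top_le_span_spike F) : OrthonormalBasis (Site (F.P n) 0 × (Fin 2 × Fin 2)) ℂ (SiteL2K ℂ 3 (periodsT3 F n) c₁ W₂)) i)) x = 0 := by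
  rw [spike_eq_lift F h ι hι i]
  exact adjoint_apply_eq_zero_off_block F U₀ Q'' hseq ι (inner_lift_eq_zero_of_disjoint F h ι hι) T hT _ (siteShift (sites_eq F n K h) i.1)
    (fun y' hy' => Pi.single_eq_of_ne hy' _) x hx

/-! ## §2 The column row: a spike column against a block-supported field -/

include hε₀ hε7 hreg hseq hι hT ha hAG in
/-- ★★ **A SPIKE COLUMN PAIRS EXPONENTIALLY SMALL WITH A FAR BLOCK**: for `u` supported in `B(z)`, every slope `μ ≥ 0` in the window (rows at `θ = μη`, `θ′ = 3μ`) and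
`‖ι(Q″λ)‖ ≤ C_T‖λ‖`: `‖⟪G(T(b_c i)), toL2S u⟫‖ ≤ 8C_P²·C_T·e^{3μ}·‖toL2S u‖·e^{−μ·tdist(z, σ i.1)}` — B1 ✓`norm_inner_massive_column_le` (source block `σ i.1`, §1) at px12's ✓B3 weight for
`y = σ i.1` (`φ = 0` on `B(y)`, `μ(tdist z y − 3) ≤ φ` on `B(z)`), `‖T(b_c i)‖ ≤ C_T` (✓`norm_adjoint_le`, `‖b_c i‖ = 1`). [cite: Balaban1985BackgroundPropagators, Thm 3.1 (3.46) p.398, (3.49) p.399] -/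
theorem norm_inner_spike_column_le {μ : ℝ} (hμ : 0 ≤ μ)
    {δ₁ : ℝ} (hδ₁ : 0 ≤ δ₁)
    (hδ : 3 * ((eta F n K)⁻¹) ^ 2 * (Real.exp (μ * eta F n K) - 1) ^ 2 + a * ((25 / 8) * (c₁ * ((((F.P K).L : ℝ) ^ (F.P K).d) ^ (K - n))⁻¹ / c₀)) * (Real.exp (3 * μ) - 1) ^ 2 ≤ δ₁ ^ 2)
    (hwin : Real.sqrt (max 2 (16 * c₀ * ((F.L : ℝ) ^ (K - n)) ^ 3 / (a * c₁))) * δ₁ ≤ 1 / 10)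
    {CT : ℝ} (hCT : 0 ≤ CT) (hCTb : ∀ l : SiteL2K ℂ 3 (periodsT3 F K) c₀ W₂, ‖ι (Q'' l)‖ ≤ CT * ‖l‖)
    (i : Site (F.P n) 0 × (Fin 2 × Fin 2)) (z : Site (F.P K) (K - n))
    (u : Site (F.P K) 0 → Matrix (Fin 2) (Fin 2) ℂ) (hu : ∀ x, iterBlockOf (K - n) x ≠ z → u x = 0) :
    ‖⟪G (T ((OrthonormalBasis.mk (orthonormal_spike F) (top_le_span_spike F) : OrthonormalBasis (Site (F.P n) 0 × (Fin 2 × Fin 2)) ℂ (SiteL2K ℂ 3 (periodsT3 F n) c₁ W₂)) i)), toL2S F K c₀ u⟫_ℂ‖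
      ≤ 8 * (max 2 (16 * c₀ * ((F.L : ℝ) ^ (K - n)) ^ 3 / (a * c₁))) * CT * Real.exp (3 * μ) * ‖toL2S F K c₀ u‖
          * Real.exp (-(μ * (Site.tdist (P := F.P K) z (siteShift (sites_eq F n K h) i.1) : ℝ))) := by
  classical
  obtain ⟨φ, φc, -, hbond, -, hosc, hzero, hfar⟩ := exists_blockDistanceWeight F h (siteShift (sites_eq F n K h) i.1) hμ
  have ht : T ((OrthonormalBasis.mk (orthonormal_spike F) (top_le_span_spike F) : OrthonormalBasis (Site (F.P n) 0 × (Fin 2 × Fin 2)) ℂ (SiteL2K ℂ 3 (periodsT3 F n) c₁ W₂)) i) = toL2S F K c₀ ((toL2S F K c₀).symm (T ((OrthonormalBasis.mk (orthonormal_spike F) (top_le_span_spike F) : OrthonormalBasis (Site (F.P n) 0 × (Fin 2 × Fin 2)) ℂ (SiteL2K ℂ 3 (periodsT3 F n) c₁ W₂)) i))) := ((toL2S F K c₀).apply_symm_apply _).symm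
  have hcol := norm_inner_massive_column_le F h hε₀ hε7 U₀ hreg Q'' hseq ι hι T hT ha G hAG ((OrthonormalBasis.mk (orthonormal_spike F) (top_le_span_spike F) : OrthonormalBasis (Site (F.P n) 0 × (Fin 2 × Fin 2)) ℂ (SiteL2K ℂ 3 (periodsT3 F n) c₁ W₂)) i) _ ht (siteShift (sites_eq F n K h) i.1)
    (spike_column_source_eq_zero_off_block F h U₀ Q'' hseq ι hι T hT i) φ φc (by positivity : (0 : ℝ) ≤ 3 * μ) hbond hosc hδ₁ hδ hwin hzero z (hfar z) u hu
  have hT1 : ‖T ((OrthonormalBasis.mk (orthonormal_spike F) (top_le_span_spike F) : OrthonormalBasis (Site (F.P n) 0 × (Fin 2 × Fin 2)) ℂ (SiteL2K ℂ 3 (periodsT3 F n) c₁ W₂)) i)‖ ≤ CT := by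
    have h1 := Prop7ComplementaryProjectorColumns.norm_adjoint_le F Q'' ι T hT hCT hCTb ((OrthonormalBasis.mk (orthonormal_spike F) (top_le_span_spike F) : OrthonormalBasis (Site (F.P n) 0 × (Fin 2 × Fin 2)) ℂ (SiteL2K ℂ 3 (periodsT3 F n) c₁ W₂)) i)
    rw [((OrthonormalBasis.mk (orthonormal_spike F) (top_le_span_spike F) : OrthonormalBasis (Site (F.P n) 0 × (Fin 2 × Fin 2)) ℂ (SiteL2K ℂ 3 (periodsT3 F n) c₁ W₂))).orthonormal.1 i, mul_one] at h1
    exact h1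
  have hCP : 0 ≤ 8 * (max 2 (16 * c₀ * ((F.L : ℝ) ^ (K - n)) ^ 3 / (a * c₁))) := by positivity
  have hexp : Real.exp (-(μ * ((Site.tdist (P := F.P K) z (siteShift (sites_eq F n K h) i.1) : ℝ) - 3)))
      = Real.exp (3 * μ) * Real.exp (-(μ * (Site.tdist (P := F.P K) z (siteShift (sites_eq F n K h) i.1) : ℝ))) := by
    rw [← Real.exp_add]; ring_nf
  calc ‖⟪G (T ((OrthonormalBasis.mk (orthonormal_spike F) (top_le_span_spike F) : OrthonormalBasis (Site (F.P n) 0 × (Fin 2 × Fin 2)) ℂ (SiteL2K ℂ 3 (periodsT3 F n) c₁ W₂)) i)), toL2S F K c₀ u⟫_ℂ‖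
      ≤ Real.exp (-(μ * ((Site.tdist (P := F.P K) z (siteShift (sites_eq F n K h) i.1) : ℝ) - 3))) * (8 * (max 2 (16 * c₀ * ((F.L : ℝ) ^ (K - n)) ^ 3 / (a * c₁)))) * ‖T ((OrthonormalBasis.mk (orthonormal_spike F) (top_le_span_spike F) : OrthonormalBasis (Site (F.P n) 0 × (Fin 2 × Fin 2)) ℂ (SiteL2K ℂ 3 (periodsT3 F n) c₁ W₂)) i)‖ * ‖toL2S F K c₀ u‖ := hcol
    _ ≤ Real.exp (-(μ * ((Site.tdist (P := F.P K) z (siteShift (sites_eq F n K h) i.1) : ℝ) - 3))) * (8 * (max 2 (16 * c₀ * ((F.L : ℝ) ^ (K - n)) ^ 3 / (a * c₁)))) * CT * ‖toL2S F K c₀ u‖ := by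
        have h0 : 0 ≤ Real.exp (-(μ * ((Site.tdist (P := F.P K) z (siteShift (sites_eq F n K h) i.1) : ℝ) - 3))) * (8 * (max 2 (16 * c₀ * ((F.L : ℝ) ^ (K - n)) ^ 3 / (a * c₁)))) := mul_nonneg (Real.exp_pos _).le hCP
        exact mul_le_mul_of_nonneg_right (mul_le_mul_of_nonneg_left hT1 h0) (norm_nonneg _)
    _ = _ := by rw [hexp]; ring

/-! ## §3 The β-row: the kernel of `P` decays between coarse blocks -/

include ha in
/-- The window row `hδ` is MONOTONE in the slope: `μ′ ≤ μ` and the row at `μ` give the row at `μ′` (both defect factors `e^{θ} − 1` increase with `θ`; the coefficients are `≥ 0`).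
[folklore] -/
theorem window_mono {μ μ' : ℝ} (hμ' : 0 ≤ μ') (hμμ' : μ' ≤ μ) {δ₁ : ℝ}
    (hδ : 3 * ((eta F n K)⁻¹) ^ 2 * (Real.exp (μ * eta F n K) - 1) ^ 2 + a * ((25 / 8) * (c₁ * ((((F.P K).L : ℝ) ^ (F.P K).d) ^ (K - n))⁻¹ / c₀)) * (Real.exp (3 * μ) - 1) ^ 2 ≤ δ₁ ^ 2) :
    3 * ((eta F n K)⁻¹) ^ 2 * (Real.exp (μ' * eta F n K) - 1) ^ 2 + a * ((25 / 8) * (c₁ * ((((F.P K).L : ℝ) ^ (F.P K).d) ^ (K - n))⁻¹ / c₀)) * (Real.exp (3 * μ') - 1) ^ 2 ≤ δ₁ ^ 2 := by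
  have hη : 0 < eta F n K := eta_pos F n K
  have hc₀ : 0 < c₀ := Fact.out
  have hc₁ : 0 < c₁ := Fact.out
  have hρ0 : 0 ≤ Real.exp (μ' * eta F n K) - 1 := by
    have := Real.one_le_exp (mul_nonneg hμ' hη.le); linarith
  have hρ'0 : 0 ≤ Real.exp (3 * μ') - 1 := by
    have := Real.one_le_exp (by positivity : 0 ≤ 3 * μ'); linarith
  have h1 : (Real.exp (μ' * eta F n K) - 1) ^ 2 ≤ (Real.exp (μ * eta F n K) - 1) ^ 2 :=
    pow_le_pow_left₀ hρ0 (sub_le_sub_right (Real.exp_le_exp.2 (mul_le_mul_of_nonneg_right hμμ' hη.le)) 1) 2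
  have h2 : (Real.exp (3 * μ') - 1) ^ 2 ≤ (Real.exp (3 * μ) - 1) ^ 2 :=
    pow_le_pow_left₀ hρ'0 (sub_le_sub_right (Real.exp_le_exp.2 (by linarith)) 1) 2
  have hk1 : 0 ≤ 3 * ((eta F n K)⁻¹) ^ 2 := by positivity
  have hk2 : 0 ≤ a * ((25 / 8) * (c₁ * ((((F.P K).L : ℝ) ^ (F.P K).d) ^ (K - n))⁻¹ / c₀)) := by
    have hL : 0 ≤ ((((F.P K).L : ℝ) ^ (F.P K).d) ^ (K - n))⁻¹ := by positivity
    have : 0 ≤ c₁ * ((((F.P K).L : ℝ) ^ (F.P K).d) ^ (K - n))⁻¹ / c₀ := div_nonneg (mul_nonneg hc₁.le hL) hc₀.le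
    exact mul_nonneg ha.le (by positivity)
  exact (add_le_add (mul_le_mul_of_nonneg_left h1 hk1) (mul_le_mul_of_nonneg_left h2 hk2)).trans hδ

/-- **THE COARSE VOLUME OVER THE SPIKE INDEX**: `Σ_{i} e^{−ν·tdist(σ i.1, σ i₀.1)} ≤ 4·(2(1 + 1∕ν))³` — four entries per site, reindexed along the bijection `σ`, px12 ✓B3 (W2).
[cite: Balaban1985BackgroundPropagators, (3.49) p.399] -/
theorem sum_exp_neg_mul_dc_spike_le {ν : ℝ} (hν : 0 < ν) (i₀ : Site (F.P n) 0 × (Fin 2 × Fin 2)) :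
    ∑ i : Site (F.P n) 0 × (Fin 2 × Fin 2), Real.exp (-(ν * (Site.tdist (P := F.P K) (siteShift (sites_eq F n K h) i.1) (siteShift (sites_eq F n K h) i₀.1) : ℝ)))
      ≤ 4 * (2 * (1 + 1 / ν)) ^ 3 := by
  have hS : ∑ s : Site (F.P n) 0, Real.exp (-(ν * (Site.tdist (P := F.P K) (siteShift (sites_eq F n K h) s) (siteShift (sites_eq F n K h) i₀.1) : ℝ))) ≤ (2 * (1 + 1 / ν)) ^ 3 :=
    (Fintype.sum_equiv (siteShift (sites_eq F n K h)) _
      (fun y : Site (F.P K) (K - n) => Real.exp (-(ν * (Site.tdist (P := F.P K) y (siteShift (sites_eq F n K h) i₀.1) : ℝ)))) (fun s => rfl)).trans_le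
      (sum_exp_neg_mul_tdist_coarse_le F hν _)
  rw [Fintype.sum_prod_type]
  simp only [Finset.sum_const, Finset.card_univ, Fintype.card_prod, Fintype.card_fin, nsmul_eq_mul, Nat.cast_mul,
    Nat.cast_ofNat]
  rw [← Finset.mul_sum]
  linarith [hS]

include hε₀ hε7 hreg hseq hι hT ha hAG hGA in
set_option maxHeartbeats 400000 in
/-- ★★★ **THE KERNEL OF PRINT'S COMPLEMENTARY GAUGE PROJECTOR DECAYS BETWEEN COARSE BLOCKS** (the β-row).  For `u` supported in the block `B(z)`, `w` supported in `B(z′)`, slopes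
`0 ≤ μ′ < μ` with the window rows at `μ` (`hδ`, `hwin`) and the gap at `μ′` (`hgap`), `‖ι(Q″λ)‖ ≤ C_T‖λ‖`, `‖G‖ ≤ C_G`, and the coarse coercivity `m_B‖f‖ ≤ ‖G(T f)‖` ((L4′)):
`‖⟪toL2S u, toL2S w − projR Δ_{U₀} Q″ (toL2S w)⟫‖ ≤ (8C_P²C_T e^{3μ}‖toL2S u‖)·(8C_P²C_T e^{3μ}‖toL2S w‖)·C_N·(4(2(1 + 1∕(μ−μ′)))³)²·e^{−μ′·tdist(z,z′)}`, `C_P² = max 2 (16c₀L^{3(K−n)}∕(ac₁))`,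
`C_N = (m_B²∕2 − 3ε(μ′)²)⁻¹e^{9μ′}` — B1 ✓`norm_inner_sub_projR_le` in the coarse spike basis, §2 twice, B2c ✓`norm_gram_inv_spike_le_exp_neg_tdist`, ✓`triple_sum_exp_le`.  K-, L-, volume-free at
the pinned weights. [cite: Balaban1985BackgroundPropagators, Thm 3.1 (3.46) p.398, (3.49) p.399; Balaban1988RG2Cluster, (2.7) p.13] -/
theorem norm_inner_sub_projR_blocks_le {μ μ' : ℝ} (hμ' : 0 ≤ μ') (hμμ' : μ' < μ)
    {δ₁ : ℝ} (hδ₁ : 0 ≤ δ₁)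
    (hδ : 3 * ((eta F n K)⁻¹) ^ 2 * (Real.exp (μ * eta F n K) - 1) ^ 2 + a * ((25 / 8) * (c₁ * ((((F.P K).L : ℝ) ^ (F.P K).d) ^ (K - n))⁻¹ / c₀)) * (Real.exp (3 * μ) - 1) ^ 2 ≤ δ₁ ^ 2)
    (hwin : Real.sqrt (max 2 (16 * c₀ * ((F.L : ℝ) ^ (K - n)) ^ 3 / (a * c₁))) * δ₁ ≤ 1 / 10)
    {CT : ℝ} (hCT : 0 ≤ CT) (hCTb : ∀ l : SiteL2K ℂ 3 (periodsT3 F K) c₀ W₂, ‖ι (Q'' l)‖ ≤ CT * ‖l‖)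
    {CG : ℝ} (hCG : 0 ≤ CG) (hGn : ∀ f, ‖G f‖ ≤ CG * ‖f‖)
    {mB : ℝ} (hmB : 0 < mB) (hcoer : ∀ f : SiteL2K ℂ 3 (periodsT3 F n) c₁ W₂, mB * ‖f‖ ≤ ‖G (T f)‖)
    (hgap : 3 * ((Real.sqrt (max 2 (16 * c₀ * ((F.L : ℝ) ^ (K - n)) ^ 3 / (a * c₁))) * (2 + Real.sqrt (max 2 (16 * c₀ * ((F.L : ℝ) ^ (K - n)) ^ 3 / (a * c₁))))
          * (Real.sqrt 3 * (eta F n K)⁻¹ * (Real.exp (μ' * eta F n K) - 1) + (Real.sqrt 3 * (eta F n K)⁻¹ * (Real.exp (μ' * eta F n K) - 1)) ^ 2 + Real.sqrt a * CT * (Real.exp (3 * μ') - 1) + a * CT ^ 2 * (Real.exp (3 * μ') - 1) ^ 2)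
          * (8 * Real.sqrt (max 2 (16 * c₀ * ((F.L : ℝ) ^ (K - n)) ^ 3 / (a * c₁))) + 8 * Real.sqrt (max 2 (16 * c₀ * ((F.L : ℝ) ^ (K - n)) ^ 3 / (a * c₁))) ^ 2)
          * (CT * (1 + (Real.exp (3 * μ') - 1))) + CG * (CT * (Real.exp (3 * μ') - 1)))) ^ 2 < mB ^ 2 / 2)
    (z z' : Site (F.P K) (K - n)) (u w : Site (F.P K) 0 → Matrix (Fin 2) (Fin 2) ℂ)
    (hu : ∀ x, iterBlockOf (K - n) x ≠ z → u x = 0) (hw : ∀ x, iterBlockOf (K - n) x ≠ z' → w x = 0) :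
    ‖⟪toL2S F K c₀ u, toL2S F K c₀ w - projR (covLapSite F n K c₀ U₀) Q'' (toL2S F K c₀ w)⟫_ℂ‖
      ≤ (8 * (max 2 (16 * c₀ * ((F.L : ℝ) ^ (K - n)) ^ 3 / (a * c₁))) * CT * Real.exp (3 * μ) * ‖toL2S F K c₀ u‖)
        * (8 * (max 2 (16 * c₀ * ((F.L : ℝ) ^ (K - n)) ^ 3 / (a * c₁))) * CT * Real.exp (3 * μ) * ‖toL2S F K c₀ w‖)
        * ((mB ^ 2 / 2 - 3 * ((Real.sqrt (max 2 (16 * c₀ * ((F.L : ℝ) ^ (K - n)) ^ 3 / (a * c₁))) * (2 + Real.sqrt (max 2 (16 * c₀ * ((F.L : ℝ) ^ (K - n)) ^ 3 / (a * c₁))))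
          * (Real.sqrt 3 * (eta F n K)⁻¹ * (Real.exp (μ' * eta F n K) - 1) + (Real.sqrt 3 * (eta F n K)⁻¹ * (Real.exp (μ' * eta F n K) - 1)) ^ 2 + Real.sqrt a * CT * (Real.exp (3 * μ') - 1) + a * CT ^ 2 * (Real.exp (3 * μ') - 1) ^ 2)
          * (8 * Real.sqrt (max 2 (16 * c₀ * ((F.L : ℝ) ^ (K - n)) ^ 3 / (a * c₁))) + 8 * Real.sqrt (max 2 (16 * c₀ * ((F.L : ℝ) ^ (K - n)) ^ 3 / (a * c₁))) ^ 2)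
          * (CT * (1 + (Real.exp (3 * μ') - 1))) + CG * (CT * (Real.exp (3 * μ') - 1)))) ^ 2)⁻¹ * Real.exp (9 * μ'))
        * (4 * (2 * (1 + 1 / (μ - μ'))) ^ 3) ^ 2
        * Real.exp (-(μ' * (Site.tdist (P := F.P K) z z' : ℝ))) := by
  classical
  have hμ : 0 ≤ μ := hμ'.trans hμμ'.le
  have hc₀ : 0 < c₀ := Fact.out
  have hc₁ : 0 < c₁ := Fact.out
  have hunit := isUnit_gram_massive_columns F T G (OrthonormalBasis.mk (orthonormal_spike F) (top_le_span_spike F) : OrthonormalBasis (Site (F.P n) 0 × (Fin 2 × Fin 2)) ℂ (SiteL2K ℂ 3 (periodsT3 F n) c₁ W₂)) hmB hcoer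
  -- the two column rows, read at the index representatives
  have hA : ∀ i : Site (F.P n) 0 × (Fin 2 × Fin 2), ‖⟪G (T ((OrthonormalBasis.mk (orthonormal_spike F) (top_le_span_spike F) : OrthonormalBasis (Site (F.P n) 0 × (Fin 2 × Fin 2)) ℂ (SiteL2K ℂ 3 (periodsT3 F n) c₁ W₂)) i)), toL2S F K c₀ u⟫_ℂ‖
      ≤ 8 * (max 2 (16 * c₀ * ((F.L : ℝ) ^ (K - n)) ^ 3 / (a * c₁))) * CT * Real.exp (3 * μ) * ‖toL2S F K c₀ u‖
          * Real.exp (-(μ * (Site.tdist (P := F.P K) z (siteShift (sites_eq F n K h) i.1) : ℝ))) :=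
    fun i => norm_inner_spike_column_le F h hε₀ hε7 U₀ hreg Q'' hseq ι hι T hT ha G hAG hμ hδ₁ hδ hwin hCT hCTb i z u hu
  have hB : ∀ i' : Site (F.P n) 0 × (Fin 2 × Fin 2), ‖⟪G (T ((OrthonormalBasis.mk (orthonormal_spike F) (top_le_span_spike F) : OrthonormalBasis (Site (F.P n) 0 × (Fin 2 × Fin 2)) ℂ (SiteL2K ℂ 3 (periodsT3 F n) c₁ W₂)) i')), toL2S F K c₀ w⟫_ℂ‖
      ≤ 8 * (max 2 (16 * c₀ * ((F.L : ℝ) ^ (K - n)) ^ 3 / (a * c₁))) * CT * Real.exp (3 * μ) * ‖toL2S F K c₀ w‖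
          * Real.exp (-(μ * (Site.tdist (P := F.P K) z' (siteShift (sites_eq F n K h) i'.1) : ℝ))) :=
    fun i' => norm_inner_spike_column_le F h hε₀ hε7 U₀ hreg Q'' hseq ι hι T hT ha G hAG hμ hδ₁ hδ hwin hCT hCTb i' z' w hw
  have hP := norm_inner_sub_projR_le F h U₀ Q'' ι hι T hT G hAG hGA (OrthonormalBasis.mk (orthonormal_spike F) (top_le_span_spike F) : OrthonormalBasis (Site (F.P n) 0 × (Fin 2 × Fin 2)) ℂ (SiteL2K ℂ 3 (periodsT3 F n) c₁ W₂)) hunit (toL2S F K c₀ u) (toL2S F K c₀ w) _ _ hA hB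
  refine hP.trans ?_
  -- the inverse Gram decay at slope `μ′`
  have hδ' := window_mono F ha hμ' hμμ'.le hδ
  have hN : ∀ i i' : Site (F.P n) 0 × (Fin 2 × Fin 2),
      ‖(Matrix.of fun i i' : Site (F.P n) 0 × (Fin 2 × Fin 2) => ⟪G (T ((OrthonormalBasis.mk (orthonormal_spike F) (top_le_span_spike F) : OrthonormalBasis (Site (F.P n) 0 × (Fin 2 × Fin 2)) ℂ (SiteL2K ℂ 3 (periodsT3 F n) c₁ W₂)) i)), G (T ((OrthonormalBasis.mk (orthonormal_spike F) (top_le_span_spike F) : OrthonormalBasis (Site (F.P n) 0 × (Fin 2 × Fin 2)) ℂ (SiteL2K ℂ 3 (periodsT3 F n) c₁ W₂)) i'))⟫_ℂ)⁻¹ i i'‖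
        ≤ (mB ^ 2 / 2 - 3 * ((Real.sqrt (max 2 (16 * c₀ * ((F.L : ℝ) ^ (K - n)) ^ 3 / (a * c₁))) * (2 + Real.sqrt (max 2 (16 * c₀ * ((F.L : ℝ) ^ (K - n)) ^ 3 / (a * c₁))))
          * (Real.sqrt 3 * (eta F n K)⁻¹ * (Real.exp (μ' * eta F n K) - 1) + (Real.sqrt 3 * (eta F n K)⁻¹ * (Real.exp (μ' * eta F n K) - 1)) ^ 2 + Real.sqrt a * CT * (Real.exp (3 * μ') - 1) + a * CT ^ 2 * (Real.exp (3 * μ') - 1) ^ 2)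
          * (8 * Real.sqrt (max 2 (16 * c₀ * ((F.L : ℝ) ^ (K - n)) ^ 3 / (a * c₁))) + 8 * Real.sqrt (max 2 (16 * c₀ * ((F.L : ℝ) ^ (K - n)) ^ 3 / (a * c₁))) ^ 2)
          * (CT * (1 + (Real.exp (3 * μ') - 1))) + CG * (CT * (Real.exp (3 * μ') - 1)))) ^ 2)⁻¹ * Real.exp (9 * μ') * Real.exp (-(μ' * (fun i j : Site (F.P n) 0 × (Fin 2 × Fin 2) => (Site.tdist (P := F.P K) (siteShift (sites_eq F n K h) i.1) (siteShift (sites_eq F n K h) j.1) : ℝ)) i i')) :=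
    fun i i' => norm_gram_inv_spike_le_exp_neg_tdist F h hε₀ hε7 U₀ hreg Q'' hseq ι hι T hT ha G hAG hμ' hδ₁ hδ' hwin hCT hCTb hCG hGn hmB hcoer hgap i i'
  -- the pseudo-metric and the volume
  have hds : ∀ i j : Site (F.P n) 0 × (Fin 2 × Fin 2), (fun i j : Site (F.P n) 0 × (Fin 2 × Fin 2) => (Site.tdist (P := F.P K) (siteShift (sites_eq F n K h) i.1) (siteShift (sites_eq F n K h) j.1) : ℝ)) i j = (fun i j : Site (F.P n) 0 × (Fin 2 × Fin 2) => (Site.tdist (P := F.P K) (siteShift (sites_eq F n K h) i.1) (siteShift (sites_eq F n K h) j.1) : ℝ)) j i := fun i j => tdist_coarse_comm F _ _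
  have hdt : ∀ i j k : Site (F.P n) 0 × (Fin 2 × Fin 2), (fun i j : Site (F.P n) 0 × (Fin 2 × Fin 2) => (Site.tdist (P := F.P K) (siteShift (sites_eq F n K h) i.1) (siteShift (sites_eq F n K h) j.1) : ℝ)) i k ≤ (fun i j : Site (F.P n) 0 × (Fin 2 × Fin 2) => (Site.tdist (P := F.P K) (siteShift (sites_eq F n K h) i.1) (siteShift (sites_eq F n K h) j.1) : ℝ)) i j + (fun i j : Site (F.P n) 0 × (Fin 2 × Fin 2) => (Site.tdist (P := F.P K) (siteShift (sites_eq F n K h) i.1) (siteShift (sites_eq F n K h) j.1) : ℝ)) j k := fun i j k => tdist_coarse_triangle F _ _ _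
  have hν : 0 < μ - μ' := sub_pos.2 hμμ'
  have hvol' : ∀ i₀ : Site (F.P n) 0 × (Fin 2 × Fin 2),
      ∑ i : Site (F.P n) 0 × (Fin 2 × Fin 2), Real.exp (-((μ - μ') * (fun i j : Site (F.P n) 0 × (Fin 2 × Fin 2) => (Site.tdist (P := F.P K) (siteShift (sites_eq F n K h) i.1) (siteShift (sites_eq F n K h) j.1) : ℝ)) i i₀)) ≤ 4 * (2 * (1 + 1 / (μ - μ'))) ^ 3 :=
    fun i₀ => sum_exp_neg_mul_dc_spike_le F h hν i₀
  have hC₁ : 0 ≤ 8 * (max 2 (16 * c₀ * ((F.L : ℝ) ^ (K - n)) ^ 3 / (a * c₁))) * CT * Real.exp (3 * μ) * ‖toL2S F K c₀ u‖ := by positivity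
  have hC₂ : 0 ≤ 8 * (max 2 (16 * c₀ * ((F.L : ℝ) ^ (K - n)) ^ 3 / (a * c₁))) * CT * Real.exp (3 * μ) * ‖toL2S F K c₀ w‖ := by positivity
  have hCN : 0 ≤ (mB ^ 2 / 2 - 3 * ((Real.sqrt (max 2 (16 * c₀ * ((F.L : ℝ) ^ (K - n)) ^ 3 / (a * c₁))) * (2 + Real.sqrt (max 2 (16 * c₀ * ((F.L : ℝ) ^ (K - n)) ^ 3 / (a * c₁))))
          * (Real.sqrt 3 * (eta F n K)⁻¹ * (Real.exp (μ' * eta F n K) - 1) + (Real.sqrt 3 * (eta F n K)⁻¹ * (Real.exp (μ' * eta F n K) - 1)) ^ 2 + Real.sqrt a * CT * (Real.exp (3 * μ') - 1) + a * CT ^ 2 * (Real.exp (3 * μ') - 1) ^ 2)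
          * (8 * Real.sqrt (max 2 (16 * c₀ * ((F.L : ℝ) ^ (K - n)) ^ 3 / (a * c₁))) + 8 * Real.sqrt (max 2 (16 * c₀ * ((F.L : ℝ) ^ (K - n)) ^ 3 / (a * c₁))) ^ 2)
          * (CT * (1 + (Real.exp (3 * μ') - 1))) + CG * (CT * (Real.exp (3 * μ') - 1)))) ^ 2)⁻¹ * Real.exp (9 * μ') :=
    mul_nonneg (le_of_lt (inv_pos.2 (sub_pos.2 hgap))) (Real.exp_pos _).le
  have h3 := triple_sum_exp_le (fun i j : Site (F.P n) 0 × (Fin 2 × Fin 2) => (Site.tdist (P := F.P K) (siteShift (sites_eq F n K h) i.1) (siteShift (sites_eq F n K h) j.1) : ℝ)) hds hdt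
    (fun i : Site (F.P n) 0 × (Fin 2 × Fin 2) => 8 * (max 2 (16 * c₀ * ((F.L : ℝ) ^ (K - n)) ^ 3 / (a * c₁))) * CT * Real.exp (3 * μ) * ‖toL2S F K c₀ u‖
      * Real.exp (-(μ * (Site.tdist (P := F.P K) z (siteShift (sites_eq F n K h) i.1) : ℝ))))
    (fun i' : Site (F.P n) 0 × (Fin 2 × Fin 2) => 8 * (max 2 (16 * c₀ * ((F.L : ℝ) ^ (K - n)) ^ 3 / (a * c₁))) * CT * Real.exp (3 * μ) * ‖toL2S F K c₀ w‖
      * Real.exp (-(μ * (Site.tdist (P := F.P K) z' (siteShift (sites_eq F n K h) i'.1) : ℝ))))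
    (fun i i' => ‖(Matrix.of fun i i' : Site (F.P n) 0 × (Fin 2 × Fin 2) => ⟪G (T ((OrthonormalBasis.mk (orthonormal_spike F) (top_le_span_spike F) : OrthonormalBasis (Site (F.P n) 0 × (Fin 2 × Fin 2)) ℂ (SiteL2K ℂ 3 (periodsT3 F n) c₁ W₂)) i)), G (T ((OrthonormalBasis.mk (orthonormal_spike F) (top_le_span_spike F) : OrthonormalBasis (Site (F.P n) 0 × (Fin 2 × Fin 2)) ℂ (SiteL2K ℂ 3 (periodsT3 F n) c₁ W₂)) i'))⟫_ℂ)⁻¹ i i'‖)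
    hC₁ hC₂ hCN hμ' (fun i' => (hB i').trans' (norm_nonneg _)) (fun _ _ => norm_nonneg _)
    ((siteShift (sites_eq F n K h)).symm z, ((0 : Fin 2), (0 : Fin 2))) ((siteShift (sites_eq F n K h)).symm z', ((0 : Fin 2), (0 : Fin 2)))
    (fun i => le_of_eq (by simp only [Equiv.apply_symm_apply])) (fun i' => le_of_eq (by simp only [Equiv.apply_symm_apply])) hN hvol'
  simp only [Equiv.apply_symm_apply] at h3
  exact h3

end Summit.QuantumFields.YangMills.Theorems.Prop7ComplementaryProjectorBlockDecay

end
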